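import Mathlib
import Summits.Ventures.HodgeRepro.Tier4.Line1.RTFSetting
import Summits.Ventures.HodgeRepro.Tier4.Line1.KernelSupportFinite
import Summits.Ventures.HodgeRepro.Tier4.Line1.KernelUnfold
import Summits.Ventures.HodgeRepro.Tier4.Line1.KernelOperator
import Summits.Ventures.HodgeRepro.Tier4.Line1.KernelEigen
import Summits.Ventures.HodgeRepro.Tier4.Line1.KernelTranslate
import Summits.Ventures.HodgeRepro.Tier4.Line1.KernelNondegenerate
import Summits.Ventures.HodgeRepro.Tier4.Line1.InnerCalculus
import Summits.Ventures.HodgeRepro.Tier4.Line1.KernelAdjoint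
import Summits.Ventures.HodgeRepro.Tier4.Line1.RelClosed
import Summits.Ventures.HodgeRepro.Tier4.Line1.RelClosedOrtho
import Summits.Ventures.HodgeRepro.Tier4.Line1.IrreducibleMinimal
import Summits.Ventures.HodgeRepro.Tier4.Line1.IrreducibleSubspace

/-!
# Tier4/Line1/J1Rung4b — LINE L1, J1-(4b) `exists_irreducible_invariant_subspace` VERBATIM

Blind re-derivation cell `pub-hodge-repro`, Tier 4 «prove the step» (README §9–§10), seat t4-L1-p4 (prover, gen 0).
The statement is BYTE-IDENTICAL to Skeleton v0.23 L478–L485 (t4-plan-1 g1; the binders `[LocallyCompactSpace G]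
[SecondCountableTopology G]` are the skeleton's since v0.18, crit-2 O-L1-(4b)-binder).  The proof is the one-line
composition of t4-L1-p1's rung (4a) `kernelOp_nondegenerate` (Tier4/Line1/KernelNondegenerate.lean) with
`exists_irreducible_invariant_subspace_of_nondegenerate` (Tier4/Line1/IrreducibleSubspace.lean, the
Deitmar–Echterhoff 9.2.7 argument run in the defined vocabulary; paper proofs/t4/L1/J1-4b.md).
`#print axioms exists_irreducible_invariant_subspace` = [propext, Classical.choice, Quot.sound].

Nothing here says anything about the status of the Hodge conjecture for CM abelian varieties, which is NOT proved;
HC_CM is NOT proved by anyone in this repository.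
-/

set_option autoImplicit false

noncomputable section

namespace Summit.Ventures.HodgeRepro.Tier4.Line1

open MeasureTheory Topology

namespace RTF

variable {G : Type} [Group G] [TopologicalSpace G] [IsTopologicalGroup G] [MeasurableSpace G]
  [BorelSpace G]

namespace Setting

variable (S : Setting G)

/-- (J1-(4b), the declared wall of J1, Deitmar–Echterhoff Lemma 9.2.7 / Thm 9.2.2): **every non-zero invariant subspace
which is `L²`-closed among the continuous invariant functions contains a non-zero IRREDUCIBLE invariant subspace** —
rung (4a) composed with the minimality argument of `IrreducibleSubspace`. -/
theorem exists_irreducible_invariant_subspace [LocallyCompactSpace G] [SecondCountableTopology G] (V : Set (G → ℂ))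
    (hV : S.IsInvariantSubspace V)
    (hclosed : ∀ ψ : G → ℂ, Continuous ψ → S.Invariant ψ →
      (∀ ε : ℝ, 0 < ε → ∃ ψ' ∈ V,
        eLpNorm (fun x => ψ x - ψ' x) 2 (S.μ.restrict S.DG) < ENNReal.ofReal ε) → ψ ∈ V)
    (hne : ∃ ψ ∈ V, ∃ x, ψ x ≠ 0) :
    ∃ V' : Set (G → ℂ), S.IsInvariantSubspace V' ∧ V' ⊆ V ∧ S.IsIrreducible V' ∧
      ∃ ψ ∈ V', ∃ x, ψ x ≠ 0 :=
  S.exists_irreducible_invariant_subspace_of_nondegenerate V hV hclosed hne S.kernelOp_nondegenerate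

end Setting

end RTF

end Summit.Ventures.HodgeRepro.Tier4.Line1
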